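import Summits.HodgeConjecture.HodgeConjecture.Theorems.F0P6aCanonicalFrobeniusIdealRows   -- ★ LA3-p03 p847883: `𝔞_can = ∏ g ∈ Ψ̃, 𝔭_{g•w}` (ρ0), costumes, rows (ρ1)–(ρ7)
import HarnessLib

/-!
# The valuation table of the canonical Frobenius twist ideal `𝔞_can(m, τR, w)` (crux hLiu418 `--supports`; L3 ARITHMETIC road, organ #3)

Cell `hodgecm-mathlib` (D-0151), P6 «MOD programme», crux `stmt-HodgeConjecture-24832` (hLiu418), line L3 (`stub_FROB`), LA3-plan DEAL v2 (3) «LA3-p03 =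
ARITHMETIC road: VALUATION TABLE OF `𝔞_can`» rows (A5) (A2) (A6) + the q-ROW JUNCTION.  THEOREMS ONLY (no definition, no instance, no notation, no named
fact, no `sorry`).  HC_CM is proved only modulo the 7 printed citations (2 remaining named inputs hLiu418 24832, h413 24833) until rung 0 closes.

TOKEN (as in ★ p847883, = GEN F-PIN-can ∕ A-p03 `stub_FPIN` RHS): `𝔞_can(m, τR, w) := ∏ τ ∈ univ.filter (m τ ≠ 0 ∧ ker (residue ∘ τR τ) ≠ 𝔭_{c•w}), ker (residue ∘ τR τ)`.
* §0 `count_finset_prod_asIdeal` — in a Dedekind domain, `ord_v (∏_{i ∈ s} 𝔭_{P i}) = #{i ∈ s : P i = v}` (the exponent of a prime in a product of primes);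
* §1 THE q-ROW JUNCTION (no Galois hypothesis): `Nat.card (𝔭_w.ResidueField) = Nat.card (𝓞 F ⧸ 𝔭_{c•w})` — turns the spine՚s `hfDeg`
  (`Nat.card (𝓞 F ⧸ 𝔭_{c•w}) = p^f`) into A-p03՚s cover-head binder `hq : Nat.card (w.asIdeal.ResidueField) = p^f` (`card_residueField_eq_of_card_quotient_smul`);
* §2 (A5) THE VALUATION TABLE (`F ∕ ℚ` Galois, `hτR` only): for every place `v ≠ c•w`,
  `ord_v 𝔞_can = #{τ : m τ ≠ 0 ∧ τ ↦ v}` (`count_prod_filter_ker_eq_card_filter`) — the exponent `k_v` the congruence relation reads on the `v`-block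
  (LEAD «M-56» (ii)); and `ord_{c•w}`-freeness is ★ p847883 (ρ7);
* §3 (A2) `𝔭_v ∣ 𝔞_can ↔ ∃ τ ↦ v, m τ ≠ 0` for `v ≠ c•w` (`asIdeal_dvd_prod_filter_ker_iff`);
* §4 (A6) at `v = w` under `hpair`∕`hcount` every embedding inducing `w` has `m ≠ 0` (★ `signature_ne_zero_of_ker_eq`), so `ord_w 𝔞_can = #{τ : τ ↦ w} = #Stab(w)`
  (`count_prod_filter_ker_self_eq_card_filter`, `card_filter_ker_eq_self_eq_card_stabilizer`);
* §5 (ED. 2, append-only) ADAPTERS from the spine ED. 4 row shapes: `hone_of_banal` (`m_pair` + `m_banal` ⇒ `hone`), `forall_eq_zero_of_unmixed` ∕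
  `forall_ne_zero_of_unmixed` (`m_unmixed` + one witness ⇒ the uniform hypotheses of the étale ∕ multiplicative bridges), `exists_ker_eq_of_smul_eq` (a witness exists).
[cite: Shimura1998, §13.1 Thm. 1 (pp. 97–99) and (7)] [cite: CasselsFrohlichANT1967, Ch. VII §1.1 and Prop. 1.2 (ii)] [cite: MilneANT2008, Thm. 3.7 (p. 42)]
-/

set_option autoImplicit false
set_option linter.dupNamespace false  -- `Summit.HodgeConjecture.HodgeConjecture.…` BY DESIGN (D-0017)

noncomputable section

open NumberField IsDedekindDomain IsLocalRing
open scoped Pointwise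
open Literature.NumberTheory.GaloisRepresentations (closureValuationSubring)
open Literature.NumberTheory.Automorphic
open Summit.HodgeConjecture.HodgeConjecture.Theorems.F0P6aKottwitzCountAtSplitPlace
open Summit.HodgeConjecture.HodgeConjecture.Theorems.F0P6aEmbeddingTorsorPlaces
open Summit.HodgeConjecture.HodgeConjecture.Theorems.F0P6aCanonicalFrobeniusIdealRows

namespace Summit.HodgeConjecture.HodgeConjecture.Theorems.F0P6aCanonicalFrobeniusIdealCounts

/-! ### §0 The exponent of a prime in a product of primes -/

section Dedekind

variable {B : Type*} [CommRing B] [IsDedekindDomain B]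

/-- **`ord_v (∏_{i ∈ s} 𝔭_{P i}) = #{i ∈ s : P i = v}`** in a Dedekind domain: the exponent of a nonzero prime in a product of nonzero primes is the number of
factors equal to it (unique factorisation; induction on `s` with `Associates.count_mul`, `count_self`, `count_eq_zero_of_ne`). [cite: MilneANT2008, Thm. 3.7 (p. 42)] -/
theorem count_finset_prod_asIdeal {ι : Type*} [DecidableEq ι] (s : Finset ι) (P : ι → HeightOneSpectrum B) (v : HeightOneSpectrum B) :
    (Associates.mk v.asIdeal).count (Associates.mk (∏ i ∈ s, (P i).asIdeal)).factors =
      (s.filter fun i => (P i).asIdeal = v.asIdeal).card := by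
  induction s using Finset.induction_on with
  | empty =>
    rw [Finset.prod_empty, Ideal.one_eq_top, Finset.filter_empty, Finset.card_empty]
    exact Literature.NumberTheory.NumberFields.count_eq_zero_of_not_le top_ne_bot fun h => v.isMaximal.ne_top (top_le_iff.1 h)
  | insert a s ha ih =>
    have hprod : (∏ i ∈ s, (P i).asIdeal) ≠ ⊥ :=
      Finset.prod_ne_zero_iff.2 fun i _ => (P i).ne_bot
    rw [Finset.prod_insert ha, ← Associates.mk_mul_mk,
      Associates.count_mul (Associates.mk_ne_zero.2 (P a).ne_bot) (Associates.mk_ne_zero.2 hprod) v.associates_irreducible, ih,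
      Finset.filter_insert]
    split_ifs with h
    · rw [← h, Associates.count_self (P a).associates_irreducible,
        Finset.card_insert_of_notMem fun hm => ha (Finset.mem_filter.1 hm).1]
      omega
    · rw [Associates.count_eq_zero_of_ne v.associates_irreducible (P a).associates_irreducible fun e =>
        h (associated_iff_eq.1 (Associates.mk_eq_mk_iff_associated.1 e)).symm, zero_add]

/-- `𝔭_v ∣ ∏_{i ∈ s} 𝔭_{P i} ↔ ∃ i ∈ s, P i = v`. [cite: MilneANT2008, Thm. 3.7 (p. 42)] -/
theorem asIdeal_dvd_finset_prod_asIdeal_iff {ι : Type*} (s : Finset ι) (P : ι → HeightOneSpectrum B) (v : HeightOneSpectrum B) :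
    v.asIdeal ∣ ∏ i ∈ s, (P i).asIdeal ↔ ∃ i ∈ s, P i = v := by
  classical
  have hprod : (∏ i ∈ s, (P i).asIdeal) ≠ ⊥ := Finset.prod_ne_zero_iff.2 fun i _ => (P i).ne_bot
  rw [← pow_one v.asIdeal, Literature.NumberTheory.NumberFields.pow_dvd_iff_le_count v hprod 1, count_finset_prod_asIdeal s P v,
    Nat.one_le_iff_ne_zero, Ne, Finset.card_eq_zero, ← Ne, ← Finset.nonempty_iff_ne_empty, Finset.filter_nonempty_iff]
  simp only [HeightOneSpectrum.ext_iff]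

end Dedekind

variable {F : Type} [Field F] [NumberField F] [IsCMField F] (w : HeightOneSpectrum (𝓞 F))

/-! ### §1 The q-row junction: `#κ(𝔭_w) = #(𝓞 F ⧸ 𝔭_{c•w})` -/

/-- **THE q-ROW JUNCTION**: `Nat.card (𝔭_w.ResidueField) = Nat.card (𝓞 F ⧸ 𝔭_{c•w})` — the residue field of the maximal ideal `𝔭_w` is `𝓞 F ⧸ 𝔭_w` (Mathlib
`Ideal.bijective_algebraMap_quotient_residueField`), and conjugate primes have residue rings of the same size (★ `HeightOneSpectrum.card_quotient_smul`).  Turns the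
spine՚s `hfDeg : Nat.card (𝓞 F ⧸ 𝔭_{c•w}) = p^f` into the cover head՚s `hq : Nat.card (w.asIdeal.ResidueField) = p^f`. [cite: CasselsFrohlichANT1967, Ch. VII §1.1] -/
theorem card_residueField_eq_card_quotient_complexConj_smul :
    Nat.card w.asIdeal.ResidueField = Nat.card (𝓞 F ⧸ ((IsCMField.complexConj F) • w).asIdeal) := by
  haveI := w.isMaximal
  rw [HeightOneSpectrum.card_quotient_smul, ← Nat.card_eq_of_bijective _ w.asIdeal.bijective_algebraMap_quotient_residueField]

/-- The junction in use: `Nat.card (𝓞 F ⧸ 𝔭_{c•w}) = q → Nat.card (𝔭_w.ResidueField) = q`. [cite: CasselsFrohlichANT1967, Ch. VII §1.1] -/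
theorem card_residueField_eq_of_card_quotient_smul {q : ℕ} (hq : Nat.card (𝓞 F ⧸ ((IsCMField.complexConj F) • w).asIdeal) = q) :
    Nat.card w.asIdeal.ResidueField = q := by
  rw [card_residueField_eq_card_quotient_complexConj_smul, hq]

section Signature

variable (τR : (F →+* AlgebraicClosure (w.adicCompletion F)) → (𝓞 F →+* ↥(closureValuationSubring (w.adicCompletion F))))
  (hτR : ∀ (τ : F →+* AlgebraicClosure (w.adicCompletion F)) (x : 𝓞 F),
    ((τR τ x : ↥(closureValuationSubring (w.adicCompletion F))) : AlgebraicClosure (w.adicCompletion F)) = τ (x : F))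
  (m : (F →+* AlgebraicClosure (w.adicCompletion F)) → ℕ)

/-! ### §2 (A5) The valuation table: `ord_v 𝔞_can = #{τ : m τ ≠ 0 ∧ τ ↦ v}` for `v ≠ c•w` -/

omit [IsCMField F] in
include hτR in
/-- **Counting embeddings along the torsor**: `#{τ : m τ ≠ 0 ∧ τ ↦ v} = #{g : m (τ_w ∘ g⁻¹) ≠ 0 ∧ 𝔭_{g • w} = 𝔭_v}` (★ dictionary `sum_filter_embeddings_eq` with `f = 1`, then
`g ↦ g⁻¹`, reading «`τ_w ∘ g` induces `g⁻¹ • w`»). [cite: CasselsFrohlichANT1967, Ch. VII §1.1] -/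
theorem card_filter_embeddings_eq_card_filter_inv [IsGalois ℚ F] (v : HeightOneSpectrum (𝓞 F)) :
    (Finset.univ.filter fun τ : F →+* AlgebraicClosure (w.adicCompletion F) =>
        m τ ≠ 0 ∧ RingHom.ker ((residue ↥(closureValuationSubring (w.adicCompletion F))).comp (τR τ)) = v.asIdeal).card =
      (Finset.univ.filter fun g : F ≃ₐ[ℚ] F =>
        m (((algebraMap (w.adicCompletion F) (AlgebraicClosure (w.adicCompletion F))).comp (algebraMap F (w.adicCompletion F))).comp
            ((g⁻¹ : F ≃ₐ[ℚ] F) : F →+* F)) ≠ 0 ∧ (g • w).asIdeal = v.asIdeal).card := by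
  classical
  rw [Finset.card_eq_sum_ones, sum_filter_embeddings_eq w, ← Finset.card_eq_sum_ones]
  refine Finset.card_equiv (Equiv.inv (F ≃ₐ[ℚ] F)) fun g => ?_
  simp only [Finset.mem_filter, Finset.mem_univ, true_and, Equiv.inv_apply, inv_inv,
    ker_residue_restrict_structural_comp_algEquiv w τR hτR]

include hτR in
/-- **(A5) THE VALUATION TABLE OF THE CANONICAL IDEAL**: for every finite place `v ≠ c•w`, `ord_v 𝔞_can(m, τR, w) = #{τ : m τ ≠ 0 ∧ τ induces v}` — the exponent
`k_v` of LEAD «M-56» (ii) (at banal `v`: `#{τ ↦ v : m τ = 2}` once `m ∈ {0,2}` there; at `v = w`: `#{τ ↦ w}` by §4).  Proof: (ρ0) `𝔞_can = ∏_{g ∈ Ψ̃} 𝔭_{g•w}` (★ p847883),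
§0, and the torsor count. [cite: Shimura1998, §13.1 Thm. 1 (pp. 97–99) and (7)] -/
theorem count_prod_filter_ker_eq_card_filter [IsGalois ℚ F] (v : HeightOneSpectrum (𝓞 F)) (hv : v ≠ (IsCMField.complexConj F) • w) :
    (Associates.mk v.asIdeal).count (Associates.mk
      (∏ τ ∈ Finset.univ.filter (fun τ : F →+* AlgebraicClosure (w.adicCompletion F) =>
          m τ ≠ 0 ∧ RingHom.ker ((residue ↥(closureValuationSubring (w.adicCompletion F))).comp (τR τ)) ≠
            (((IsCMField.complexConj F) • w).asIdeal : Ideal (𝓞 F))),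
        RingHom.ker ((residue ↥(closureValuationSubring (w.adicCompletion F))).comp (τR τ)))).factors =
    (Finset.univ.filter fun τ : F →+* AlgebraicClosure (w.adicCompletion F) =>
        m τ ≠ 0 ∧ RingHom.ker ((residue ↥(closureValuationSubring (w.adicCompletion F))).comp (τR τ)) = v.asIdeal).card := by
  classical
  rw [prod_filter_ker_eq_prod_invHalfType w τR hτR m, count_finset_prod_asIdeal _ (fun g : F ≃ₐ[ℚ] F => g • w) v, Finset.filter_filter,
    card_filter_embeddings_eq_card_filter_inv w τR hτR m v]
  congr 1
  refine Finset.filter_congr fun g _ => ?_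
  constructor
  · rintro ⟨⟨hm, -⟩, hgv⟩
    exact ⟨hm, hgv⟩
  · rintro ⟨hm, hgv⟩
    refine ⟨⟨hm, ?_⟩, hgv⟩
    rw [hgv]
    exact fun h => hv (HeightOneSpectrum.ext h)

/-! ### §3 (A2) `𝔭_v ∣ 𝔞_can ↔ ∃ τ ↦ v, m τ ≠ 0` -/

include hτR in
/-- **(A2) `𝔭_v ∣ 𝔞_can ↔ ∃ τ, m τ ≠ 0 ∧ τ induces v`** for `v ≠ c•w` (the valuation table read at exponent `≥ 1`). [cite: Shimura1998, §13.1 Thm. 1 (pp. 97–99) and (7)] -/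
theorem asIdeal_dvd_prod_filter_ker_iff [IsGalois ℚ F] (v : HeightOneSpectrum (𝓞 F)) (hv : v ≠ (IsCMField.complexConj F) • w) :
    v.asIdeal ∣
      (∏ τ ∈ Finset.univ.filter (fun τ : F →+* AlgebraicClosure (w.adicCompletion F) =>
          m τ ≠ 0 ∧ RingHom.ker ((residue ↥(closureValuationSubring (w.adicCompletion F))).comp (τR τ)) ≠
            (((IsCMField.complexConj F) • w).asIdeal : Ideal (𝓞 F))),
        RingHom.ker ((residue ↥(closureValuationSubring (w.adicCompletion F))).comp (τR τ))) ↔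
      ∃ τ : F →+* AlgebraicClosure (w.adicCompletion F),
        m τ ≠ 0 ∧ RingHom.ker ((residue ↥(closureValuationSubring (w.adicCompletion F))).comp (τR τ)) = v.asIdeal := by
  classical
  rw [prod_filter_ker_eq_prod_invHalfType w τR hτR m, asIdeal_dvd_finset_prod_asIdeal_iff]
  constructor
  · rintro ⟨g, hg, hgv⟩
    rw [Finset.mem_filter] at hg
    refine ⟨((algebraMap (w.adicCompletion F) (AlgebraicClosure (w.adicCompletion F))).comp (algebraMap F (w.adicCompletion F))).comp
      ((g⁻¹ : F ≃ₐ[ℚ] F) : F →+* F), hg.2.1, ?_⟩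
    exact (ker_residue_restrict_structural_comp_inv_eq_iff w τR hτR g v).2 hgv
  · rintro ⟨τ, hm, hker⟩
    obtain ⟨g, rfl⟩ := exists_algEquiv_eq_structural_comp w τ
    refine ⟨g⁻¹, ?_, ?_⟩
    · rw [Finset.mem_filter, inv_inv]
      refine ⟨Finset.mem_univ _, hm, ?_⟩
      rw [(ker_residue_restrict_structural_comp_algEquiv_eq_iff w τR hτR g v).1 hker]
      exact fun h => hv (HeightOneSpectrum.ext h)
    · exact (ker_residue_restrict_structural_comp_algEquiv_eq_iff w τR hτR g v).1 hker

/-! ### §4 (A6) At `v = w`: `ord_w 𝔞_can = #{τ : τ ↦ w} = #Stab(w)` -/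

include hτR in
/-- **(A6) `ord_w 𝔞_can = #{τ : τ induces w}`** under the signature laws `hpair`∕`hcount`: every embedding inducing `w` has `m ≠ 0` (★ `signature_ne_zero_of_ker_eq`), so the
signature condition drops out of the valuation table at `v = w`. [cite: Shimura1998, §13.1 Thm. 1 (pp. 97–99) and (7)] [cite: RapoportSmithlingZhang2020Diagonal, §4.1 (4.6) p. 16] -/
theorem count_prod_filter_ker_self_eq_card_filter [IsGalois ℚ F] (hw : (IsCMField.complexConj F) • w ≠ w)
    (hpair : ∀ τ : F →+* AlgebraicClosure (w.adicCompletion F),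
      m τ + m (τ.comp ((IsCMField.complexConj F : F ≃ₐ[↥(maximalRealSubfield F)] F) : F →+* F)) = 2)
    (hcount : ∑ τ ∈ (Finset.univ.filter fun τ : F →+* AlgebraicClosure (w.adicCompletion F) =>
        RingHom.ker ((residue ↥(closureValuationSubring (w.adicCompletion F))).comp (τR τ)) =
          (((IsCMField.complexConj F) • w).asIdeal : Ideal (𝓞 F))), m τ = 1) :
    (Associates.mk w.asIdeal).count (Associates.mk
      (∏ τ ∈ Finset.univ.filter (fun τ : F →+* AlgebraicClosure (w.adicCompletion F) =>
          m τ ≠ 0 ∧ RingHom.ker ((residue ↥(closureValuationSubring (w.adicCompletion F))).comp (τR τ)) ≠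
            (((IsCMField.complexConj F) • w).asIdeal : Ideal (𝓞 F))),
        RingHom.ker ((residue ↥(closureValuationSubring (w.adicCompletion F))).comp (τR τ)))).factors =
    (Finset.univ.filter fun τ : F →+* AlgebraicClosure (w.adicCompletion F) =>
        RingHom.ker ((residue ↥(closureValuationSubring (w.adicCompletion F))).comp (τR τ)) = w.asIdeal).card := by
  classical
  rw [count_prod_filter_ker_eq_card_filter w τR hτR m w (Ne.symm hw)]
  congr 1
  refine Finset.filter_congr fun τ _ => ⟨fun h => h.2, fun h => ⟨signature_ne_zero_of_ker_eq w τR hτR m hpair hcount τ h, h⟩⟩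

omit [IsCMField F] in
include hτR in
/-- **`#{τ : τ induces w} = #Stab(w)`** (the torsor: `τ_w ∘ g` induces `w` iff `g ∈ Stab(w)`, and `Stab(w)` is closed under inversion) — so under `hpair`∕`hcount`,
`ord_w 𝔞_can = #Stab(w) = e_w f_w`. [cite: CasselsFrohlichANT1967, Ch. VII Prop. 1.2 (ii)] -/
theorem card_filter_ker_eq_self_eq_card_stabilizer [IsGalois ℚ F] [DecidableEq (HeightOneSpectrum (𝓞 F))] :
    (Finset.univ.filter fun τ : F →+* AlgebraicClosure (w.adicCompletion F) =>
        RingHom.ker ((residue ↥(closureValuationSubring (w.adicCompletion F))).comp (τR τ)) = w.asIdeal).card =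
      (Finset.univ.filter fun g : F ≃ₐ[ℚ] F => g • w = w).card := by
  classical
  rw [Finset.card_eq_sum_ones, sum_filter_embeddings_eq w, ← Finset.card_eq_sum_ones]
  congr 1
  refine Finset.filter_congr fun g _ => ?_
  rw [ker_residue_restrict_structural_comp_algEquiv_eq_self_iff w τR hτR g]

/-! ### §5 (ED. 2, append-only) ADAPTERS from the spine ED. 4 row shapes (`m_pair`, `m_banal`, `m_unmixed`) to the hypotheses used above -/

/-- **`hone` FROM THE SPINE ROWS `m_pair` + `m_banal`**: if `m τ + m (τ ∘ c) = 2` everywhere and `m ∈ {0, 2}` at every embedding inducing neither `w` nor `c•w`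
(the ED. 4 tokens of `RGDInputsAt.m_pair` ∕ `m_banal`, GEN cand v1 :314–:324), then `m τ = 1` forces `τ` to induce `w` or `c•w` — the hypothesis `hone` of ★ p847748 §4,
★ p847883 and this file. [cite: RapoportSmithlingZhang2020Diagonal, §3.2 (3.8) p. 11, Rem. 3.6 (3.14) p. 13] -/
theorem hone_of_banal
    (hbanal : ∀ τ : F →+* AlgebraicClosure (w.adicCompletion F),
      RingHom.ker ((residue ↥(closureValuationSubring (w.adicCompletion F))).comp (τR τ)) ≠ (w.asIdeal : Ideal (𝓞 F)) →
      RingHom.ker ((residue ↥(closureValuationSubring (w.adicCompletion F))).comp (τR τ)) ≠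
        (((IsCMField.complexConj F) • w).asIdeal : Ideal (𝓞 F)) →
      m τ = 0 ∨ m τ = 2)
    (τ : F →+* AlgebraicClosure (w.adicCompletion F)) (h1 : m τ = 1) :
    RingHom.ker ((residue ↥(closureValuationSubring (w.adicCompletion F))).comp (τR τ)) = w.asIdeal ∨
      RingHom.ker ((residue ↥(closureValuationSubring (w.adicCompletion F))).comp (τR τ)) = ((IsCMField.complexConj F) • w).asIdeal := by
  by_contra h
  rw [not_or] at h
  rcases hbanal τ h.1 h.2 with h0 | h2 <;> omega

/-- **UNMIXED ⇒ UNIFORM VANISHING**: under the ED. 4 row shape `m_unmixed` («embeddings inducing the same banal place have the same signature»), ONE embedding inducing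
`u` with `m = 0` makes `m = 0` at EVERY embedding inducing `u` — the hypothesis of the étale bridge (★ `F0P6aCanonicalFrobeniusIdealBanalBridges` §2).
[cite: RapoportSmithlingZhang2020Diagonal, §3.2 (3.8) p. 11, Rem. 3.6 (3.14) p. 13] -/
theorem forall_eq_zero_of_unmixed
    (hunmixed : ∀ τ τ' : F →+* AlgebraicClosure (w.adicCompletion F),
      RingHom.ker ((residue ↥(closureValuationSubring (w.adicCompletion F))).comp (τR τ)) =
        RingHom.ker ((residue ↥(closureValuationSubring (w.adicCompletion F))).comp (τR τ')) →
      RingHom.ker ((residue ↥(closureValuationSubring (w.adicCompletion F))).comp (τR τ)) ≠ (w.asIdeal : Ideal (𝓞 F)) →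
      RingHom.ker ((residue ↥(closureValuationSubring (w.adicCompletion F))).comp (τR τ)) ≠
        (((IsCMField.complexConj F) • w).asIdeal : Ideal (𝓞 F)) →
      m τ = m τ')
    (u : HeightOneSpectrum (𝓞 F)) (huw : u ≠ w) (huc : u ≠ (IsCMField.complexConj F) • w)
    (τ₀ : F →+* AlgebraicClosure (w.adicCompletion F))
    (hτ₀ : RingHom.ker ((residue ↥(closureValuationSubring (w.adicCompletion F))).comp (τR τ₀)) = u.asIdeal) (h0 : m τ₀ = 0)
    (τ : F →+* AlgebraicClosure (w.adicCompletion F))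
    (hτ : RingHom.ker ((residue ↥(closureValuationSubring (w.adicCompletion F))).comp (τR τ)) = u.asIdeal) : m τ = 0 := by
  rw [hunmixed τ τ₀ (hτ.trans hτ₀.symm) (hτ ▸ fun h => huw (HeightOneSpectrum.ext h)) (hτ ▸ fun h => huc (HeightOneSpectrum.ext h)), h0]

/-- **UNMIXED ⇒ UNIFORM NON-VANISHING**: likewise ONE embedding inducing `u` with `m ≠ 0` makes `m ≠ 0` at every embedding inducing `u` — the hypothesis of the
multiplicative bridge (★ `F0P6aCanonicalFrobeniusIdealBanalBridges` §3). [cite: RapoportSmithlingZhang2020Diagonal, §3.2 (3.8) p. 11, Rem. 3.6 (3.14) p. 13] -/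
theorem forall_ne_zero_of_unmixed
    (hunmixed : ∀ τ τ' : F →+* AlgebraicClosure (w.adicCompletion F),
      RingHom.ker ((residue ↥(closureValuationSubring (w.adicCompletion F))).comp (τR τ)) =
        RingHom.ker ((residue ↥(closureValuationSubring (w.adicCompletion F))).comp (τR τ')) →
      RingHom.ker ((residue ↥(closureValuationSubring (w.adicCompletion F))).comp (τR τ)) ≠ (w.asIdeal : Ideal (𝓞 F)) →
      RingHom.ker ((residue ↥(closureValuationSubring (w.adicCompletion F))).comp (τR τ)) ≠
        (((IsCMField.complexConj F) • w).asIdeal : Ideal (𝓞 F)) →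
      m τ = m τ')
    (u : HeightOneSpectrum (𝓞 F)) (huw : u ≠ w) (huc : u ≠ (IsCMField.complexConj F) • w)
    (τ₀ : F →+* AlgebraicClosure (w.adicCompletion F))
    (hτ₀ : RingHom.ker ((residue ↥(closureValuationSubring (w.adicCompletion F))).comp (τR τ₀)) = u.asIdeal) (h0 : m τ₀ ≠ 0)
    (τ : F →+* AlgebraicClosure (w.adicCompletion F))
    (hτ : RingHom.ker ((residue ↥(closureValuationSubring (w.adicCompletion F))).comp (τR τ)) = u.asIdeal) : m τ ≠ 0 := by
  rw [hunmixed τ τ₀ (hτ.trans hτ₀.symm) (hτ ▸ fun h => huw (HeightOneSpectrum.ext h)) (hτ ▸ fun h => huc (HeightOneSpectrum.ext h))]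
  exact h0

omit [IsCMField F] in
include hτR in
/-- **EVERY PLACE OVER `p` IS INDUCED BY SOME EMBEDDING** (`F ∕ ℚ` Galois): for `u` conjugate to `w` (`u = g • w`), the embedding `τ_w ∘ g⁻¹` induces `u` — so the
`τ₀` of the two adapters above exists as soon as `u ∣ p` (transitivity of `Gal(F∕ℚ)` on the primes over `p`). [cite: CasselsFrohlichANT1967, Ch. VII Prop. 1.2 (ii)] -/
theorem exists_ker_eq_of_smul_eq [IsGalois ℚ F] (u : HeightOneSpectrum (𝓞 F)) (g : F ≃ₐ[ℚ] F) (hg : g • w = u) :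
    ∃ τ : F →+* AlgebraicClosure (w.adicCompletion F),
      RingHom.ker ((residue ↥(closureValuationSubring (w.adicCompletion F))).comp (τR τ)) = u.asIdeal :=
  ⟨((algebraMap (w.adicCompletion F) (AlgebraicClosure (w.adicCompletion F))).comp (algebraMap F (w.adicCompletion F))).comp
      ((g⁻¹ : F ≃ₐ[ℚ] F) : F →+* F), (ker_residue_restrict_structural_comp_inv_eq_iff w τR hτR g u).2 hg⟩

end Signature

end Summit.HodgeConjecture.HodgeConjecture.Theorems.F0P6aCanonicalFrobeniusIdealCounts

end
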